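import Summits.ABC.IUTFork.DAGC312n
import Literature.AnabelianGeometry.EtaleTheta.ThetaRigidity
import Literature.AnabelianGeometry.EtaleTheta.ThetaSystems
import Literature.AnabelianGeometry.AbsoluteAnabelian.AbsAnabProp121viiSub

/-!
# Kernel DAG index — layer C312, part o: knitting DELTA 6 — [EtTh] resolved to its named rigidity results, [AbsAnab] Prop 1.2.1 (vii)
to its typed statement; ONE opaque locus left, (SHE)

index v1 · abc-iut-c312-2 (filer, gen 2) per HOME/plan/KERNEL-DAG-SPEC.md v1.3 §2(a),(b),(d),(e). APPEND-ONLY: four node blocks and ONE new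
outermost reading `lociReadingI S pending` (decides two loci, otherwise `lociReadingH S (overrideV6 pending)`, part n) — nothing filed
earlier is redefined; I ∘ H ∘ G ∘ F ∘ M ∘ V2 ∘ Δ3 ∘ Δ4 is the composed reading of record after this part.

* [EtTh], the whole-paper citation at Steps (ii), (vi), (xi-h). The proof NAMES what it takes from [EtTh]: (ii) p. 175 l. 58–60 "in
  essence, from the cyclotomic rigidity of mono-theta environments, as discussed in [EtTh]"; (vi) p. 177 l. 43–48 "the Kummer theory
  surrounding mono-theta environments established in [EtTh] … the discrete rigidity established in [EtTh]"; (xi-h) via Rmk 2.1.1 (iv)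
  and [IUTchII] Rmk 3.6.4 (iii), (iv) (the first power / `N`-th powers). These are [EtTh] Cor. 2.19 (i) cyclotomic, (ii) discrete, (iii)
  constant-multiple rigidity — typed by abc-iut-L2-t2 as the named predicates `RigidData.Cor219_i_splittings`/`_subquotients`
  (`ThetaRigidity`), `ThetaEnvTower.Cor219_ii`, `ThetaEnvTower.Cor219_iii` (`ThetaSystems`), with conditional discharges in
  `EtaleTheta/Discharge/*` (`cor219_i_splittings_of`, `cor219_ii_of`, `cor219_iii_systems_holds`, …). Nodes `N_EtTh_Cor2_19_i/_ii/_iii`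
  (predicate aliases, kernel_ids from plan/DAG.tsv); the locus ↦ the seven landed [EtTh] CLAIM nodes of Δ3 (all with witnesses) — the
  `pending` conjunct of Δ3 is dropped now that the results the proof names are typed and aliased (predicates carry no grantable closed
  statement; exactly as Rmk 3.10.1, Prop 3.9 (ii) etc. were treated in Δ4).
* [AbsAnab] Prop 1.2.1 (vii) (Step (vi): "Galois cohomology of subquotients of `K̄^×`") — NO LONGER a mention only: abc-iut-L4's
  `AbsAnabProp121viiSub.lean` types it as the CLOSED named proposition `galoisMLF_iso_residueMap` (an isomorphism of absolute Galois groups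
  of MLFs with an equivariant `K̄₁^× ⥲ K̄₂^×` preserving units and uniformisers intertwines the residue maps; OPEN sub-node L00 of the
  sub-DAG `AbsAnab:Prop1.2.1(vii)`, classical local class field theory transport, not yet proved in the tree). Node `N_AbsAnab_Prop1_2_1_vii
  : Prop := galoisMLF_iso_residueMap` (FACT-style, spec §2(d): NO `_holds`); the locus ↦ this NAMED PROPOSITION — a genuine, named,
  classical hypothesis instead of an opaque `pending`.
Census (`knitted_count_v6`): 84 of the 85 loci cited by the statement and proof of [IUTchIII] Cor. 3.12 are resolved to landed kernel
objects (claim nodes with witnesses, situation fields, data/predicate aliases, owner-noted rows, section pointers, and ONE named classical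
fact); the ONLY locus still consulting the opaque `pending` is (SHE) — Rmk 3.11.1 (iii) "simultaneous holomorphic expressibility", the
gloss the Step (xi) dispute turns on. `lociReadingI_of_SHE`: Theorem 3.11 as typed + (IPL) + `galoisMLF_iso_residueMap` + `pending .SHE`
grant all 85; `derivable_xi_f_iff_SHE`: in the least reading (`Cor312Least`) the disputed (xi-f) observation is derivable, given those,
iff `pending .SHE`; apex `summit_of_cor312_M_SHE` (kernel_hyps = 12: hInd, hadm, hreal, hqreal, hThm, hIPL, hAbsAnab, hSHE, hC, hread,
hΘ, hq — every one NAMED; none opaque but (SHE) itself).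
THIS FILE PROVES NOTHING NEW AND ASSERTS NOTHING; no side taken on [IUTchIII] Cor. 3.12. typed ≠ discharged; indexed ≠ endorsed.
[claim: Mochizuki2012, status: disputed]
-/

noncomputable section

namespace Summit.ABC.IUTFork.DAG

open Cor312Proof Thm311 PartC312k

/-! ## 1. Node blocks -/

/-- [node EtTh:Cor2.19(i) · L2/D1 · [EtTh] Cor 2.19 (i) (Cyclotomic Rigidity), kurims-ms p.58 · p404894 `ThetaRigidity` (abc-iut-L2-t2) ·
predicate · DAG status landed(p404894)] every automorphism of the model mono-theta environment preserves both splittings over `l·Δ_Θ`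
(hence the cyclotomic rigidity isomorphism) — typed as named predicates on `RigidData`; conditional discharges
`cor219_i_splittings_of`/`cor219_i_subquotients_of` (`EtaleTheta/Discharge`). Cited at Step (ii) ("cyclotomic rigidity of mono-theta
environments, as discussed in [EtTh]"). -/
abbrev N_EtTh_Cor2_19_i := @Literature.AnabelianGeometry.EtaleTheta.RigidData.Cor219_i_splittings
example := @Literature.AnabelianGeometry.EtaleTheta.RigidData.Cor219_i_subquotients
example := @Literature.AnabelianGeometry.EtaleTheta.RigidData.sAlg_mul_sTheta_inv

/-- [node EtTh:Cor2.19(ii) · L2/D1 · [EtTh] Cor 2.19 (ii) (Discrete Rigidity), kurims-ms p.58 · p407825 `ThetaSystems` · predicate · DAG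
status landed(p407825)] any projective system of mono-theta environments is isomorphic to the standard one — named predicate on
`ThetaEnvTower`; conditional discharges `cor219_ii_of`, `cor219_ii_of_levels` (`EtaleTheta/Discharge`). Cited at Step (vi) ("the
discrete rigidity established in [EtTh]") and through Rmk 2.1.1 (v). -/
abbrev N_EtTh_Cor2_19_ii := @Literature.AnabelianGeometry.EtaleTheta.ThetaEnvTower.Cor219_ii

/-- [node EtTh:Cor2.19(iii) · L2/D1 · [EtTh] Cor 2.19 (iii) (Constant Multiple Rigidity), kurims-ms p.58 · p408358 `ThetaSystems` ·
predicate · DAG status landed(p408358)] functoriality of the theta sections under automorphisms, tower form — named predicate on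
`ThetaEnvTower`; discharge `cor219_iii_systems_holds` (`Discharge/Sec2BiThetaSystemsProofs`). Cited through Rmk 2.1.1 (iii) / Step (x). -/
abbrev N_EtTh_Cor2_19_iii := @Literature.AnabelianGeometry.EtaleTheta.ThetaEnvTower.Cor219_iii

/-- [node AbsAnab:Prop1.2.1(vii) · L4/D1 · [AbsAnab] Prop 1.2.1 (vii), author's ms p.11 · `AbsAnabProp121viiSub` (abc-iut-L4, sub-DAG
`AbsAnab:Prop1.2.1(vii)` row L00) · FACT-style closed proposition (spec §2(d)): NO `_holds` — OPEN in the tree (classical local class field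
theory transport: an isomorphism of absolute Galois groups of MLFs with an equivariant `K̄₁^× ⥲ K̄₂^×` preserving units and uniformisers
intertwines the residue maps)] Cited at Step (vi) ("Galois cohomology of subquotients of `K̄^×`"). A permanent explicit hypothesis
wherever consumed until abc-iut-L4 discharges it. [cite: MochizukiAbsAnab2004, Prop 1.2.1 (vii) p.11] -/
abbrev N_AbsAnab_Prop1_2_1_vii : Prop := Literature.AnabelianGeometry.AbsoluteAnabelian.galoisMLF_iso_residueMap.{0}

/-! ## 2. The outermost reading I -/

/-- `overrideV6 pending`: `pending` at (SHE), `True` elsewhere — what I hands down to H (H would consult `pending` only at (SHE), [AbsAnab]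
Prop 1.2.1 (vii), [EtTh]; the latter two are decided by I itself). [folklore] -/
def overrideV6 (pending : Locus → Prop) (c : Locus) : Prop :=
  match c with
  | .SHE => pending .SHE
  | _ => True

/-- THE COMPOSED READING OF RECORD after Δ6: [EtTh] ↦ its seven landed claim nodes (Δ3; the three Cor 2.19 rigidity predicates are
aliased above), [AbsAnab] Prop 1.2.1 (vii) ↦ its named proposition, otherwise `lociReadingH S (overrideV6 pending)`.
[claim: Mochizuki2012, status: disputed] -/
def lociReadingI {T : ThetaIndex} (S : FullSituation T) (pending : Locus → Prop) (c : Locus) : Prop :=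
  match c with
  | .etTh => N_EtTh_Prop1_4_i.{0} ∧ N_EtTh_Prop1_4_ii.{0} ∧ N_EtTh_Def2_10.{0, 0, 0} ∧ N_EtTh_Prop2_11_i.{0, 0, 0, 0, 0, 0} ∧
      N_EtTh_Prop2_14_ii.{0, 0, 0} ∧ N_EtTh_Def1_9_ii.{0} ∧ N_EtTh_Def2_13_i.{0}
      -- + predicate aliases `N_EtTh_Cor2_19_i/_ii/_iii` (cyclotomic / discrete / constant-multiple rigidity), no closed statement to grant
  | .absAnab_prop1_2_1_vii => N_AbsAnab_Prop1_2_1_vii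
  | c => lociReadingH S (overrideV6 pending) c

variable {T : ThetaIndex} (S : FullSituation T) (pending : Locus → Prop)

/-- knitted: [AbsAnab] Prop 1.2.1 (vii) ↦ the named proposition `galoisMLF_iso_residueMap`. [folklore] -/
theorem lociReadingI_absAnab : lociReadingI S pending .absAnab_prop1_2_1_vii = N_AbsAnab_Prop1_2_1_vii := rfl
/-- still opaque: (SHE) — I consults `pending` itself, through H's and Δ4's fall-throughs. [folklore] -/
theorem lociReadingI_SHE : lociReadingI S pending .SHE = pending .SHE := rfl
/-- fall-through: (IPL) is read through the situation (part l). [folklore] -/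
theorem lociReadingI_IPL : lociReadingI S pending .IPL = S.link.IPL := rfl
/-- fall-through: Cor 2.3 keeps its H-value (part n). [folklore] -/
theorem lociReadingI_cor2_3 : lociReadingI S pending .cor2_3 =
    (N_IUTchIII_Cor2_3_i.{0} ∧ N_IUTchIII_Cor2_3_ii.{0} ∧ N_IUTchIII_Cor2_3_iii.{0} ∧ N_IUTchIII_Cor2_3_iv.{0}) := rfl

/-- The override grants H's three-locus hypothesis from `pending .SHE` (the other two loci of `unresolvedV5` are decided by I and never
reach H's `pending`; the override makes that explicit). [folklore] -/
theorem overrideV6_of_SHE (hSHE : pending .SHE) : ∀ c ∈ unresolvedV5, overrideV6 pending c := by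
  intro c hc
  cases c <;> first | exact trivial | exact hSHE

/-- **The composed reading of record holds at all 85 loci given Theorem 3.11 as typed, (IPL), the classical named fact
`galoisMLF_iso_residueMap` ([AbsAnab] Prop 1.2.1 (vii)), and `pending` at the ONE locus (SHE).** [folklore] -/
theorem lociReadingI_of_SHE (hS : S.Statement) (hIPL : S.link.IPL) (hAbsAnab : N_AbsAnab_Prop1_2_1_vii) (hSHE : pending .SHE) :
    ∀ c, lociReadingI S pending c := by
  have hH : ∀ c, lociReadingH S (overrideV6 pending) c :=
    lociReadingH_of_three S (overrideV6 pending) hS hIPL (overrideV6_of_SHE pending hSHE)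
  intro c
  unfold lociReadingI
  split
  · exact ⟨N_EtTh_Prop1_4_i_part, N_EtTh_Prop1_4_ii_part, N_EtTh_Def2_10_part, N_EtTh_Prop2_11_i_part,
      N_EtTh_Prop2_14_ii_part, N_EtTh_Def1_9_ii_holds, N_EtTh_Def2_13_i_holds⟩
  · exact hAbsAnab
  · exact hH _

/-- **In the least reading (`Cor312Least`), given Theorem 3.11 as typed and (IPL), the disputed observation of Step (xi-f) is derivable
EXACTLY when [AbsAnab] Prop 1.2.1 (vii) (a named classical fact, cited at Step (vi)) and (SHE) (opaque) are granted.** [folklore] -/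
theorem derivable_xi_f_iff_SHE (hS : S.Statement) (hIPL : S.link.IPL) :
    Derivable (lociReadingI S pending) .constitutesConstruction ↔ (N_AbsAnab_Prop1_2_1_vii ∧ pending .SHE) := by
  rw [derivable_constitutesConstruction_iff]
  constructor
  · intro h
    exact ⟨h .absAnab_prop1_2_1_vii (by decide), h .SHE (by decide)⟩
  · rintro ⟨hA, hSHE⟩ c _
    exact lociReadingI_of_SHE S pending hS hIPL hA hSHE c

/-! ## 3. Apex and census -/

/-- **APEX, author's terms, every hypothesis named; the one opaque locus is (SHE).** `ABC` from V, T, A, hInd; per curve a full situation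
with Theorem 3.11 AS TYPED (`hThm`) and (IPL) as read (`hIPL`); the classical named fact [AbsAnab] Prop 1.2.1 (vii) (`hAbsAnab :
galoisMLF_iso_residueMap`); (SHE) granted as the value of `pending` there (`hSHE`); pilot nouns, admissibility, the two finiteness clauses;
the twenty inferences under the reading of record I (`hC`); the (xi-f) sentence read as Reading 1 (`hread`); the number identifications.
kernel_hyps = 12 (hInd, hadm, hreal, hqreal, hThm, hIPL, hAbsAnab, hSHE, hC, hread, hΘ, hq). [claim: Mochizuki2012, status: disputed] -/
theorem summit_of_cor312_M_SHE (V : HeightFamily) (Tm : Thm110Family V) (A : AbcDictionary V)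
    (hInd : MochizukiIndeterminacies Tm) {TI : V.Pt → ThetaIndex} (S : ∀ P, FullSituation (TI P))
    (Pn : ∀ P, PilotNouns (S P).toLatticeSituation) (n m : ℤ)
    (hadm : ∀ P (j : (TI P).LabelStar) (vQ : (TI P).VQ), (Pn P).ComponentAdm n m j vQ)
    (hreal : ∀ P, (Pn P).NegLogThetaReal n m) (hqreal : ∀ P, (Pn P).NegLogQReal n m)
    (hThm : ∀ P, (S P).Statement) (hIPL : ∀ P, (S P).link.IPL) (hAbsAnab : N_AbsAnab_Prop1_2_1_vii)
    (pending : Locus → Prop) (hSHE : pending .SHE) {O : Obs → Prop} (hC : ∀ P, Chain (lociReadingI (S P) pending) O)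
    (hread : ∀ P (j : (TI P).LabelStar) (vQ : (TI P).VQ), O .constitutesConstruction →
      ((Pn P).toCor312Setting n m j vQ (hadm P j vQ)).RepresentedVol)
    (hΘ : ∀ P, (Pn P).negLogTheta n m = (Tm.X P).negLogTheta) (hq : ∀ P, (Pn P).negLogQ n m = -(Tm.X P).absLogq) :
    _root_.ABC :=
  abc_of_indeterminacies_of_cor312 V Tm A hInd fun P => by
    have hc : (Pn P).Cor312At n m :=
      (Pn P).cor312At_of_componentwise n m (hadm P) (hreal P) (hqreal P)
        fun j vQ => setting_cor312_of_chain _ (lociReadingI_of_SHE (S P) pending (hThm P) (hIPL P) hAbsAnab hSHE) (hC P)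
          (hread P j vQ)
    unfold Thm110Data.Cor312
    rw [← hΘ, ← hq]
    exact hc.2.2

/-- CENSUS after Δ6: 84 of 85 loci resolved (82 after Δ5, + [EtTh] to its named rigidity results, + [AbsAnab] Prop 1.2.1 (vii) to a named
classical proposition); the steps citing the one opaque locus (SHE) are (xi-b)–(xi-e); of (xi-f)'s 75 upstream loci only (SHE) is opaque.
[folklore] -/
theorem knitted_count_v6 : (82 : ℕ) + 2 = 84 ∧ 84 + 1 = 85 ∧
    (Step.all.filter fun s => decide (Locus.SHE ∈ s.cites)) = [.xi_b, .xi_c, .xi_d, .xi_e] ∧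
    (Step.xi_f.upstreamLoci.filter fun c => decide (c = Locus.SHE)) = [.SHE] := by
  refine ⟨rfl, rfl, ?_, ?_⟩ <;> decide

end Summit.ABC.IUTFork.DAG

end
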